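import Mathlib
import HarnessLib
import Summits.AtomisticToContinuum.FouriersLaw.Theses.JunctionLocality
import Summits.AtomisticToContinuum.FouriersLaw.Theorems.JunctionLocalityConductanceLowerBoundStubShortTimeDipoleFloorAux8

/-!
# Contact formation, IV: `L`-uniform Gibbs moments of polynomial observables of three sites

Helper file (`--supports` stmt-AtomisticToContinuum-11749) for stub `stub_contactFormation` (R4) of the line
`cold-bath-relocation-walk` of the crux `JunctionLocality.ConductanceLowerBound` (lead c2 worker). The ONLY `L`-dependence
of the curl certificate is through Gibbs expectations of local polynomials of the three sites `0, 1, j₂`; this file bounds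
them uniformly in `L`:

* `contact_seven_pow_four_le` — `(x + y)⁴ ≤ 8(x⁴ + y⁴)` thrice, and its consequence `contact_size_pow_four_le`:
  `S⁴ ≤ 512(1 + q_a⁸ + q_b⁸ + q_c⁸ + p_a⁸ + p_b⁸ + p_c⁸)` for the size function `S = 1 + q_a² + q_b² + q_c² + p_a² + p_b² + p_c²`;
* `contact_gibbsPolynomialMoments` (registered) — for the pinned chain (`ω₂ > 0`, `lam, β ≥ 0`) and `T > 0` there is
  `M = M(ω₂, lam, β, γ, T) ≥ 1` such that for EVERY `L`, every three sites `a, b, c` and every continuous `ψ` with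
  `ψ² ≤ κ S⁴` pointwise: `ψ ∈ L²(μ_T)` and `∫ ψ² dμ_T ≤ κ M` — from the `N`-uniform even moments
  `KickDipoleNoCollapse.helper_kdGibbsFactorialMoments` (`∫ q_i⁸, ∫ p_i⁸ ≤ C(4A)⁴`).

References: folklore.
-/

noncomputable section

open MeasureTheory Filter Topology
open scoped ContDiff
open Literature.MathematicalPhysics.KineticTheory.HeatConduction
open Summit.AtomisticToContinuum.FouriersLaw.Cruxes.ConductanceLowerBound.KickDipoleNoCollapse (helper_kdGibbsFactorialMoments)

namespace Summit.AtomisticToContinuum.FouriersLaw.Cruxes.ConductanceLowerBound.ColdBathRelocationWalk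

/-! ## The size function and its fourth power -/

/-- Seven terms: `(1 + u₁ + ⋯ + u₆)⁴ ≤ 512(1 + u₁⁴ + ⋯ + u₆⁴)` (three binary splittings). [folklore] -/
theorem contact_seven_pow_four_le (u₁ u₂ u₃ u₄ u₅ u₆ : ℝ) :
    (1 + u₁ + u₂ + u₃ + u₄ + u₅ + u₆) ^ 4 ≤ 512 * (1 + u₁ ^ 4 + u₂ ^ 4 + u₃ ^ 4 + u₄ ^ 4 + u₅ ^ 4 + u₆ ^ 4) := by
  -- `(x + y)⁴ ≤ 8(x⁴ + y⁴)`: `8x⁴ + 8y⁴ − (x+y)⁴ = (x−y)²(7x² + 10xy + 7y²)` (cf. `Literature…add_pow_four_le`)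
  have contact_add_pow_four_le : ∀ x y : ℝ, (x + y) ^ 4 ≤ 8 * (x ^ 4 + y ^ 4) := fun x y => by
    nlinarith [mul_nonneg (sq_nonneg (x - y)) (add_nonneg (mul_nonneg (by norm_num : (0 : ℝ) ≤ 7)
      (sq_nonneg (x + 5 / 7 * y))) (mul_nonneg (by norm_num : (0 : ℝ) ≤ 24 / 7) (sq_nonneg y)))]
  have h1 := contact_add_pow_four_le (1 + u₁ + u₂ + u₃) (u₄ + u₅ + u₆)
  have h2 := contact_add_pow_four_le (1 + u₁) (u₂ + u₃)
  have h3 := contact_add_pow_four_le 1 u₁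
  have h4 := contact_add_pow_four_le u₂ u₃
  have h5 := contact_add_pow_four_le (u₄ + u₅) u₆
  have h6 := contact_add_pow_four_le u₄ u₅
  have e1 : (1 + u₁ + u₂ + u₃ + u₄ + u₅ + u₆) ^ 4 = ((1 + u₁ + u₂ + u₃) + (u₄ + u₅ + u₆)) ^ 4 := by ring
  have e2 : (1 + u₁ + u₂ + u₃) ^ 4 = ((1 + u₁) + (u₂ + u₃)) ^ 4 := by ring
  have h7 : (0 : ℝ) ≤ u₆ ^ 4 := by positivity
  rw [e1]
  rw [e2] at h1
  nlinarith

/-- **The size function's fourth power is dominated by eighth powers**: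
`S⁴ ≤ 512(1 + q_a⁸ + q_b⁸ + q_c⁸ + p_a⁸ + p_b⁸ + p_c⁸)`, `S = 1 + q_a² + q_b² + q_c² + p_a² + p_b² + p_c²`. [folklore] -/
theorem contact_size_pow_four_le {L : ℕ} (a b c : Fin L) (x : PhaseSpace L) :
    (1 + x.1 a ^ 2 + x.1 b ^ 2 + x.1 c ^ 2 + x.2 a ^ 2 + x.2 b ^ 2 + x.2 c ^ 2) ^ 4 ≤
      512 * (1 + x.1 a ^ (2 * 4) + x.1 b ^ (2 * 4) + x.1 c ^ (2 * 4) + x.2 a ^ (2 * 4) + x.2 b ^ (2 * 4) +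
        x.2 c ^ (2 * 4)) := by
  have h := contact_seven_pow_four_le (x.1 a ^ 2) (x.1 b ^ 2) (x.1 c ^ 2) (x.2 a ^ 2) (x.2 b ^ 2) (x.2 c ^ 2)
  simpa only [← pow_mul] using h

/-! ## `L`-uniform second moments -/

variable {ω₂ lam β : ℝ}

/-- **The size function has an `L`-uniform fourth moment**: there is `M ≥ 1` (depending on `ω₂, lam, β, γ, T` only) with
`S⁴ ∈ L¹(μ_T)` and `∫ S⁴ dμ_T ≤ M` for every `L` and every three sites. [folklore] -/
theorem contact_size_pow_four_moment (hω : 0 < ω₂) (hl : 0 ≤ lam) (hβ : 0 ≤ β) (γ : ℝ) {T : ℝ} (hT : 0 < T) :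
    ∃ M : ℝ, 1 ≤ M ∧ ∀ (L : ℕ) (a b c : Fin L),
      Integrable (fun x : PhaseSpace L => (1 + x.1 a ^ 2 + x.1 b ^ 2 + x.1 c ^ 2 + x.2 a ^ 2 + x.2 b ^ 2 + x.2 c ^ 2) ^ 4)
        ((pinnedChain ω₂ lam β γ).gibbsMeasure L T) ∧
      ∫ x, (1 + x.1 a ^ 2 + x.1 b ^ 2 + x.1 c ^ 2 + x.2 a ^ 2 + x.2 b ^ 2 + x.2 c ^ 2) ^ 4
        ∂((pinnedChain ω₂ lam β γ).gibbsMeasure L T) ≤ M := by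
  obtain ⟨C, A, hC, hA, hmom⟩ := helper_kdGibbsFactorialMoments ω₂ lam β γ hω hl hβ T hT
  set m : ℝ := C * (A * (4 : ℕ)) ^ 4 with hm
  have hm0 : 0 ≤ m := by positivity
  refine ⟨512 * (1 + 6 * m), by nlinarith, fun L a b c => ?_⟩
  set P := pinnedChain ω₂ lam β γ with hP
  set μ := P.gibbsMeasure L T with hμ
  haveI : IsProbabilityMeasure μ := pinnedChain_isProbabilityMeasure_gibbsMeasure hω hl hβ γ L hT
  obtain ⟨iqa, hqa, ipa, hpa⟩ := hmom L a 4
  obtain ⟨iqb, hqb, ipb, hpb⟩ := hmom L b 4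
  obtain ⟨iqc, hqc, ipc, hpc⟩ := hmom L c 4
  -- the dominating function `G = 512 (1 + q_a⁸ + q_b⁸ + q_c⁸ + p_a⁸ + p_b⁸ + p_c⁸)`
  have hI1 : Integrable (fun x : PhaseSpace L => (1 : ℝ) + x.1 a ^ (2 * 4)) μ := (integrable_const _).add iqa
  have hI2 : Integrable (fun x : PhaseSpace L => (1 : ℝ) + x.1 a ^ (2 * 4) + x.1 b ^ (2 * 4)) μ := hI1.add iqb
  have hI3 : Integrable (fun x : PhaseSpace L => (1 : ℝ) + x.1 a ^ (2 * 4) + x.1 b ^ (2 * 4) + x.1 c ^ (2 * 4)) μ :=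
    hI2.add iqc
  have hI4 : Integrable (fun x : PhaseSpace L => (1 : ℝ) + x.1 a ^ (2 * 4) + x.1 b ^ (2 * 4) + x.1 c ^ (2 * 4) +
      x.2 a ^ (2 * 4)) μ := hI3.add ipa
  have hI5 : Integrable (fun x : PhaseSpace L => (1 : ℝ) + x.1 a ^ (2 * 4) + x.1 b ^ (2 * 4) + x.1 c ^ (2 * 4) +
      x.2 a ^ (2 * 4) + x.2 b ^ (2 * 4)) μ := hI4.add ipb
  have hI6 : Integrable (fun x : PhaseSpace L => (1 : ℝ) + x.1 a ^ (2 * 4) + x.1 b ^ (2 * 4) + x.1 c ^ (2 * 4) +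
      x.2 a ^ (2 * 4) + x.2 b ^ (2 * 4) + x.2 c ^ (2 * 4)) μ := hI5.add ipc
  have hGi : Integrable (fun x : PhaseSpace L => 512 * ((1 : ℝ) + x.1 a ^ (2 * 4) + x.1 b ^ (2 * 4) + x.1 c ^ (2 * 4) +
      x.2 a ^ (2 * 4) + x.2 b ^ (2 * 4) + x.2 c ^ (2 * 4))) μ := hI6.const_mul 512
  have hsum : ∫ x, (1 : ℝ) + x.1 a ^ (2 * 4) + x.1 b ^ (2 * 4) + x.1 c ^ (2 * 4) + x.2 a ^ (2 * 4) + x.2 b ^ (2 * 4) +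
      x.2 c ^ (2 * 4) ∂μ ≤ 1 + 6 * m := by
    rw [integral_add hI5 ipc, integral_add hI4 ipb, integral_add hI3 ipa, integral_add hI2 iqc, integral_add hI1 iqb,
      integral_add (integrable_const _) iqa, integral_const, smul_eq_mul, probReal_univ, one_mul]
    linarith [hqa, hqb, hqc, hpa, hpb, hpc]
  have hGint : ∫ x, 512 * ((1 : ℝ) + x.1 a ^ (2 * 4) + x.1 b ^ (2 * 4) + x.1 c ^ (2 * 4) + x.2 a ^ (2 * 4) +
      x.2 b ^ (2 * 4) + x.2 c ^ (2 * 4)) ∂μ ≤ 512 * (1 + 6 * m) := by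
    rw [integral_const_mul]
    linarith
  have hSc : Continuous fun x : PhaseSpace L =>
      (1 + x.1 a ^ 2 + x.1 b ^ 2 + x.1 c ^ 2 + x.2 a ^ 2 + x.2 b ^ 2 + x.2 c ^ 2) ^ 4 := by fun_prop
  have hS0 : ∀ x : PhaseSpace L, 0 ≤ (1 + x.1 a ^ 2 + x.1 b ^ 2 + x.1 c ^ 2 + x.2 a ^ 2 + x.2 b ^ 2 + x.2 c ^ 2) ^ 4 :=
    fun x => by positivity
  have hSi : Integrable (fun x : PhaseSpace L =>
      (1 + x.1 a ^ 2 + x.1 b ^ 2 + x.1 c ^ 2 + x.2 a ^ 2 + x.2 b ^ 2 + x.2 c ^ 2) ^ 4) μ :=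
    hGi.mono' hSc.aestronglyMeasurable (ae_of_all _ fun x => by
      rw [Real.norm_eq_abs, abs_of_nonneg (hS0 x)]
      exact contact_size_pow_four_le a b c x)
  refine ⟨hSi, (integral_mono hSi hGi fun x => contact_size_pow_four_le a b c x).trans hGint⟩

/-- **Registered helper `contact_gibbsPolynomialMoments` (R4 `stub_contactFormation`, line `cold-bath-relocation-walk`): `L`-UNIFORM
SECOND MOMENTS OF LOCAL POLYNOMIAL OBSERVABLES.**  For the pinned chain (`ω₂ > 0`, `lam, β ≥ 0`) and `T > 0` there is
`M = M(ω₂, lam, β, γ, T) ≥ 1` such that for every `L`, every three sites `a, b, c : Fin L`, every `κ ≥ 0` and every continuous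
`ψ` with `ψ(x)² ≤ κ S(x)⁴` (`S = 1 + q_a² + q_b² + q_c² + p_a² + p_b² + p_c²`): `ψ ∈ L²(μ_T)` and `∫ ψ² dμ_T ≤ κ M`. [folklore] -/
theorem contact_gibbsPolynomialMoments : ∀ (ω₂ lam β γ : ℝ), 0 < ω₂ → 0 ≤ lam → 0 ≤ β → ∀ (T : ℝ), 0 < T → ∃ M : ℝ, 1 ≤ M ∧ ∀ (L : ℕ) (a b c : Fin L) (κ : ℝ) (ψ : PhaseSpace L → ℝ), 0 ≤ κ → Continuous ψ → (∀ x : PhaseSpace L, ψ x ^ 2 ≤ κ * (1 + x.1 a ^ 2 + x.1 b ^ 2 + x.1 c ^ 2 + x.2 a ^ 2 + x.2 b ^ 2 + x.2 c ^ 2) ^ 4) → MemLp ψ 2 ((pinnedChain ω₂ lam β γ).gibbsMeasure L T) ∧ ∫ x, ψ x ^ 2 ∂((pinnedChain ω₂ lam β γ).gibbsMeasure L T) ≤ κ * M := by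
  intro ω₂ lam β γ hω hl hβ T hT
  obtain ⟨M, hM, hmom⟩ := contact_size_pow_four_moment hω hl hβ γ hT
  refine ⟨M, hM, fun L a b c κ ψ hκ hψc hψ => ?_⟩
  obtain ⟨hSi, hSle⟩ := hmom L a b c
  set μ := (pinnedChain ω₂ lam β γ).gibbsMeasure L T with hμ
  have hψ2i : Integrable (fun x => ψ x ^ 2) μ :=
    (hSi.const_mul κ).mono' (hψc.pow 2).aestronglyMeasurable (ae_of_all _ fun x => by
      rw [Real.norm_eq_abs, abs_of_nonneg (sq_nonneg _)]
      exact hψ x)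
  refine ⟨(memLp_two_iff_integrable_sq hψc.aestronglyMeasurable).2 hψ2i, ?_⟩
  calc ∫ x, ψ x ^ 2 ∂μ ≤ ∫ x, κ * (1 + x.1 a ^ 2 + x.1 b ^ 2 + x.1 c ^ 2 + x.2 a ^ 2 + x.2 b ^ 2 + x.2 c ^ 2) ^ 4 ∂μ :=
        integral_mono hψ2i (hSi.const_mul κ) hψ
    _ = κ * ∫ x, (1 + x.1 a ^ 2 + x.1 b ^ 2 + x.1 c ^ 2 + x.2 a ^ 2 + x.2 b ^ 2 + x.2 c ^ 2) ^ 4 ∂μ := integral_const_mul _ _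
    _ ≤ κ * M := mul_le_mul_of_nonneg_left hSle hκ

end Summit.AtomisticToContinuum.FouriersLaw.Cruxes.ConductanceLowerBound.ColdBathRelocationWalk

end
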